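import Literature.Algebra.EuclideanLattices.KhotRecoverable
import Literature.Algebra.EuclideanLattices.KhotCounting
import HarnessLib

/-!
# Khot 2005: the assembly — deterministic compositions, the error over the random row vector, the sampled shift, the total error

Topic `Algebra/EuclideanLattices`, namespace `Literature.Algebra.EuclideanLattices.Khot`. Eighth
brick of the decomposition of `Literature.Algebra.EuclideanLattices.gapSVP_const_isNPHardRandomized`
(pqc.S17) through `Khot2005_SAT_randReducible_gapSVP` (`KhotSVPHardness.lean`). It composes the
landed bricks (`KhotTensorBoost`, `KhotBasicReduction`, `KhotGapInstance`, `KhotRandomSublattice`,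
`KhotCounting`, `KhotRecoverable`; `BCHIndependence`, `GapSetCover`) into the statement that
Khot's instances are `GapSVP` YES/NO instances outside an explicitly counted set of bad random
choices. Everything here is PROVED; what it leaves to the next brick is the CHOICE of the
parameters discharging the (abstract) numeric side conditions, and the machine level.

## Contents

1. **Deterministic compositions** (`section Output`, `section Base`): `outMatrix B₀ W k p₀ Kpad`
   (the `k`-fold boosted basis `augPowMatrix`, padded by `Kpad·e_o` on `augPad p₀ k`; the instance
   is `(columnInstance (squareOf (outMatrix …) eR eC), τ)`), `outMatrix_mem_gapSVP_no`
   (NO-structure ⇒ `GapSVP.no`: Lemma 7.2 `le_intSqNorm_augPow`, `le_intSqNorm_padCols`,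
   `squareOf_no`, `columnInstance_mem_gapSVP_no`), `outMatrix_mem_gapSVP_yes` (YES data ⇒
   `GapSVP.yes`: Lemma 7.1 `short_vector_of_yes`, `padCols_mulVec_inl`, `squareOf_yes`,
   `columnInstance_mem_gapSVP_yes`); for Khot's base `baseBasis = finBasis (intBasis Q F P s') r D q`:
   `baseBasis_mulVec_eq_zero`, `base_mem_gapSVP_no` (the kill event of Lemma 5.6 ⇒ NO;
   `noStructure_finBasis`, `recoverable_finBasis_intBasis`), `base_mem_gapSVP_yes` (exact cover +
   a surviving good vector ⇒ YES; `goodVector_data`, `yes_finBasis`).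
2. **The random row vector** (`section RowVectors`): `khotInstance … r` (the output on
   `r ∈ (ℤ/q)^{rows}`, with `Kpad = T + growth·c₁·T + 1` computed from the sampled data),
   `card_bad_no_le` (`100·#{bad r} ≤ q^{rows}` given `100·#A·D ≤ q`; Lemma 5.6 via
   `card_not_kill_mul_le`), `card_bad_yes_mul_le` (`#{bad r}·K_{s'} ≤ q^{rows+1}`; Lemma 5.7 via
   `card_no_good_survivor_mul_le`).
3. **The sampled shift** (`section Shift`, Lemma 4.3 with an `r`-TUPLE of uniform column
   indices): `parityVec`, `tupleShift`, `mem_goodSets_tupleShift_iff` (good sets = parity fibre),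
   `card_sameParity_inj_le` (tuple-to-set loss `rr^rr`), `card_smallParity_inj_le` (`≤ 2ʰB`
   injective tuples in small fibres).
4. **Total error** over `Ω = (tuples) × (ℤ/q)^{rows}` (`section Total`): `card_bad_no_total_le`
   (`≤ 1/100`), `card_bad_yes_total_le` (`≤ 2/100` under the sampling conditions
   `100·(C + 2ʰB') ≤ |N|^{rr}`, `100·q·rr^{rr} ≤ B'`).

## Faithfulness / rendering

Printed (Thm. 5.1, p. 799): "with probability at least `9/10`" on each side, prime
`q ∈ [100#A, #G/100]` (§5.2.1), Lemma 4.3 for a random `r`-subset. Here: arbitrary modulus with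
`100·#A·D ≤ q` (see `KhotRandomSublattice.lean`); the `r` columns sampled as a tuple (collisions
charged to the error, tuple-to-set factor `rr^rr` in the count); the padding constant computed
from the sampled data; errors `1/100` (NO) and `2/100` (YES). The statement of the vendored fact
(two-sided error `≤ 1/3` for every constant `γ₀ ≥ 1`) is unaffected by these proof choices.

## References

* S. Khot, *Hardness of approximating the shortest vector problem in lattices*, J. ACM 52 (2005)
  789–808, Lemma 4.3, Thm. 5.1, §5.2.1–5.2.2, Lemmas 5.6–5.7, §7.1–7.3.
-/

noncomputable section

namespace Literature.Algebra.EuclideanLattices.Khot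

open Matrix Finset

/-! ### The output instance -/

section Output

variable {R₀ C₀ : Type} [Fintype R₀] [Fintype C₀] [DecidableEq R₀] [DecidableEq C₀]

/-- `Out` inherits decidable equality. [folklore] -/
instance instDecidableEqOut : (j : ℕ) → DecidableEq (Out R₀ C₀ j)
  | 0 => inferInstanceAs (DecidableEq R₀)
  | j + 1 => haveI := instDecidableEqOut j
      inferInstanceAs (DecidableEq ((R₀ × Coef C₀ j) ⊕ (R₀ × Out R₀ C₀ j)))

/-- **The matrix output by Khot's reduction (before reindexing)**: the `k`-fold boosted basis
`augPowMatrix B₀ W k` of a base basis `B₀` (there: the final lattice of Thm. 5.1), padded by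
`Kpad · e_o` on the rows `augPad p₀ k`. [cite: Khot2005, §7.3] -/
def outMatrix (B₀ : Matrix R₀ C₀ ℤ) (W : ℤ) (k : ℕ) (p₀ : R₀ → Prop) [DecidablePred p₀] (Kpad : ℤ) :
    Matrix (Out R₀ C₀ k) (Coef C₀ k ⊕ {o // augPad (n := C₀) p₀ k o}) ℤ :=
  padCols (augPowMatrix B₀ W k) Kpad (augPad p₀ k)

/-- **NO side, deterministic composition** (Lemma 7.2 + padding + bridge). If the base basis
`B₀` has independent columns and the NO-structure of Thm. 5.1 (3) for `d, D` (e.g. by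
`Khot.noStructure_finBasis`), is recoverable from the rows outside `p₀` with distortion `c₁ ≥ 0`,
and the numeric side conditions hold — `W ≥ 1`, `W²d^{k+1} ≤ D²` (boosting), `0 ≤ T`,
`W²d^{k+1} ≤ (T+1)²`, `T + growth·c₁·T < Kpad` (padding), `N ≥ 1`, `τ > 0`,
`(γ(N)·τ)² < W²d^{k+1}`, `γ(N) ≥ 0` (threshold) — then the reindexed square instance is a NO
instance of `GapSVP_γ`. [cite: Khot2005, §7.2–7.3] -/
theorem outMatrix_mem_gapSVP_no {B₀ : Matrix R₀ C₀ ℤ} (hB₀ : ∀ x, B₀ *ᵥ x = 0 → x = 0)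
    {d D : ℕ} (hNO : NoStructure B₀ d D) {p₀ : R₀ → Prop} [DecidablePred p₀] {c₁ : ℤ}
    (hc₁ : 0 ≤ c₁) (hrec : Recoverable B₀ p₀ c₁) {W : ℤ} (hW : 1 ≤ W) (k : ℕ)
    (hDk : W ^ 2 * (d : ℤ) ^ (k + 1) ≤ (D : ℤ) ^ 2) {T Kpad : ℤ} (hT : 0 ≤ T)
    (hbT : W ^ 2 * (d : ℤ) ^ (k + 1) ≤ (T + 1) ^ 2)
    (hK : T + growth (augPowMatrix B₀ W k) * (c₁ * T) < Kpad)
    {N : ℕ} (hN : 0 < N) (eR : Out R₀ C₀ k ≃ Fin N)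
    (eC : (Coef C₀ k ⊕ {o // augPad (n := C₀) p₀ k o}) ≃ Fin N)
    {γ : ℕ → ℝ} (hγ : 0 ≤ γ N) {τ : ℚ} (hτ : 0 < τ)
    (hlt : (γ N * τ) ^ 2 < ((W ^ 2 * (d : ℤ) ^ (k + 1) : ℤ) : ℝ)) :
    (columnInstance (squareOf (outMatrix B₀ W k p₀ Kpad) eR eC), τ) ∈ GapSVP.no γ := by
  have hW0 : W ≠ 0 := by omega
  -- Lemma 7.2 in matrix form
  have hb : ∀ X : Coef C₀ k → ℤ, X ≠ 0 → W ^ 2 * (d : ℤ) ^ (k + 1) ≤ intSqNorm (augPowMatrix B₀ W k *ᵥ X) :=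
    fun X hX => by rw [augPowMatrix_mulVec]; exact le_intSqNorm_augPow hB₀ hNO hW0 k hDk X hX
  -- recoverability of the boosted matrix, padding
  have hrecK : Recoverable (augPowMatrix B₀ W k) (augPad p₀ k) c₁ := recoverable_augPowMatrix hrec hW k
  have hKpad0 : Kpad ≠ 0 := by
    have : 0 ≤ growth (augPowMatrix B₀ W k) * (c₁ * T) :=
      mul_nonneg (Finset.sum_nonneg fun _ _ => Finset.sum_nonneg fun _ _ => abs_nonneg _) (mul_nonneg hc₁ hT)
    intro h; rw [h] at hK; linarith
  have hpad : ∀ v, v ≠ 0 → W ^ 2 * (d : ℤ) ^ (k + 1) ≤ intSqNorm (outMatrix B₀ W k p₀ Kpad *ᵥ v) :=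
    fun v hv => le_intSqNorm_padCols hb hrecK hc₁ hT hbT hK v hv
  have hinj : ∀ v, outMatrix B₀ W k p₀ Kpad *ᵥ v = 0 → v = 0 :=
    fun v hv => padCols_mulVec_eq_zero hrecK hKpad0 v hv
  -- reindex and bridge
  exact columnInstance_mem_gapSVP_no hN (squareOf_mulVec_eq_zero hinj eR eC) hτ
    (fun u hu => squareOf_no hpad eR eC u hu) hγ hlt

/-- **YES side, deterministic composition** (Lemma 7.1 + padding + bridge). If the base basis
`B₀` has independent columns and is recoverable (for nonsingularity of the padded square basis),
and a nonzero coefficient vector `x` with `‖x‖² ≤ s`, `‖B₀x‖² ≤ g`, `g ≥ 2` is given (e.g. by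
`Khot.yes_finBasis` from a surviving good vector), `W ≥ 1`, `s^k ≤ W²`, `Kpad ≠ 0`, `τ > 0` and
`2W²g^{k+1} ≤ τ²`, then the reindexed square instance is a YES instance of `GapSVP_γ`.
[cite: Khot2005, §7.1 and §7.3] -/
theorem outMatrix_mem_gapSVP_yes {B₀ : Matrix R₀ C₀ ℤ} (hB₀ : ∀ x, B₀ *ᵥ x = 0 → x = 0)
    {p₀ : R₀ → Prop} [DecidablePred p₀] {c₁ : ℤ} (hrec : Recoverable B₀ p₀ c₁)
    {W g s : ℤ} (hW : 1 ≤ W) (hg2 : 2 ≤ g) {x : C₀ → ℤ} (hx : x ≠ 0) (hs : intSqNorm x ≤ s)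
    (hg : intSqNorm (B₀ *ᵥ x) ≤ g) (k : ℕ) (hsW : s ^ k ≤ W ^ 2) {Kpad : ℤ} (hKpad : Kpad ≠ 0)
    {N : ℕ} (eR : Out R₀ C₀ k ≃ Fin N) (eC : (Coef C₀ k ⊕ {o // augPad (n := C₀) p₀ k o}) ≃ Fin N)
    (γ : ℕ → ℝ) {τ : ℚ} (hτ : 0 < τ) (hle : ((2 * W ^ 2 * g ^ (k + 1) : ℤ) : ℝ) ≤ (τ : ℝ) ^ 2) :
    (columnInstance (squareOf (outMatrix B₀ W k p₀ Kpad) eR eC), τ) ∈ GapSVP.yes γ := by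
  have hW0 : W ≠ 0 := by omega
  obtain ⟨hne, hbound⟩ := short_vector_of_yes hB₀ hW0 hg2 hx hs hg k hsW k le_rfl
  -- matrix form and padding
  have hv : outMatrix B₀ W k p₀ Kpad *ᵥ Sum.elim (tpow x k) 0 = augPow B₀ W k (tpow x k) := by
    rw [outMatrix, padCols_mulVec_inl, augPowMatrix_mulVec]
  have hrecK : Recoverable (augPowMatrix B₀ W k) (augPad p₀ k) c₁ := recoverable_augPowMatrix hrec hW k
  have hinj : ∀ v, outMatrix B₀ W k p₀ Kpad *ᵥ v = 0 → v = 0 :=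
    fun v hv => padCols_mulVec_eq_zero hrecK hKpad v hv
  obtain ⟨hne', hbound'⟩ := squareOf_yes (outMatrix B₀ W k p₀ Kpad) eR eC (v := Sum.elim (tpow x k) 0)
    (g := 2 * W ^ 2 * g ^ (k + 1)) (by rw [hv]; exact hne) (by rw [hv]; exact hbound)
  exact columnInstance_mem_gapSVP_yes γ (squareOf_mulVec_eq_zero hinj eR eC) hτ hne'
    ((Int.cast_le.2 hbound').trans hle)

end Output

/-! ### Khot's base: the final lattice of Thm. 5.1, and the two compositions with its events -/

section Base

variable {U S H Nn : Type} [Fintype U] [Fintype S] [Fintype H] [Fintype Nn]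
variable [DecidableEq U] [DecidableEq S] [DecidableEq H] [DecidableEq Nn]

/-- The final basis of Thm. 5.1 has independent columns when `B` has and `D, q ≠ 0`.
[cite: Khot2005, §5.2.2] -/
theorem finBasis_mulVec_eq_zero {R C : Type} [Fintype R] [Fintype C] {B : Matrix R C ℤ}
    (hB : ∀ x, B *ᵥ x = 0 → x = 0) (r : R → ℤ) {D q : ℤ} (hD : D ≠ 0) (hq : q ≠ 0)
    (v : C ⊕ Unit → ℤ) (hv : finBasis B r D q *ᵥ v = 0) : v = 0 := by
  have hveq : v = Sum.elim (v ∘ Sum.inl) (fun _ => v (Sum.inr ())) := by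
    funext i; rcases i with i | ⟨⟩ <;> rfl
  rw [hveq, finBasis_mulVec] at hv
  have hx : B *ᵥ (v ∘ Sum.inl) = 0 := by
    funext i; exact congrFun hv (Sum.inl i)
  have hx0 := hB _ hx
  have hl : v (Sum.inr ()) = 0 := by
    have := congrFun hv (Sum.inr ())
    simp only [Sum.elim_inr, Pi.zero_apply, hx, dotProduct_zero, zero_add, mul_eq_zero, hD,
      false_or] at this
    exact this.resolve_right hq
  rw [hveq, hx0, hl]
  funext i; rcases i with i | ⟨⟩ <;> rfl

/-- **Khot's base basis**: `B₀ = finBasis (intBasis Q F P s') r D q` (Thm. 5.1, Figs. 3–4).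
[cite: Khot2005, §5.2.2 (Fig. 4)] -/
abbrev baseBasis (Q : ℤ) (F : S → Finset U) (P : Matrix H Nn ℤ) (s' : H → ℤ)
    (r : (U ⊕ S) ⊕ (H ⊕ Nn) → ℤ) (D q : ℤ) :
    Matrix (((U ⊕ S) ⊕ (H ⊕ Nn)) ⊕ Unit) (((S ⊕ (Nn ⊕ H)) ⊕ Unit) ⊕ Unit) ℤ :=
  finBasis (intBasis Q F P s') r D q

/-- Independence of the columns of the base basis (`Q, D, q ≠ 0`, universe nonempty).
[cite: Khot2005, Thm. 3.1 (1) and §5] -/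
theorem baseBasis_mulVec_eq_zero [Nonempty U] {Q : ℤ} (hQ : Q ≠ 0) (F : S → Finset U)
    (P : Matrix H Nn ℤ) (s' : H → ℤ) (r : (U ⊕ S) ⊕ (H ⊕ Nn) → ℤ) {D q : ℤ} (hD : D ≠ 0)
    (hq : q ≠ 0) (v : ((S ⊕ (Nn ⊕ H)) ⊕ Unit) ⊕ Unit → ℤ) (hv : baseBasis Q F P s' r D q *ᵥ v = 0) :
    v = 0 :=
  finBasis_mulVec_eq_zero (intBasis_mulVec_eq_zero hQ F P s') r hD hq v hv

/-- **NO side for Khot's base** (Lemma 5.6 event ⇒ Thm. 5.1 (3) ⇒ Lemma 7.2 ⇒ gap instance):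
if the row vector `r` (entries in `[0,q)`, `q ≥ 1`) kills every annoying vector of the
intermediate lattice, then — with `Q, D ≥ 1`, `{0,1}`-data `P, s'` (recoverability) and the
numeric side conditions of `outMatrix_mem_gapSVP_no` (base distortion
`c₁ = n·Q·(4|S|+3|N|+5)+1`) — the output instance is a NO instance of `GapSVP_γ`. (The NO
hypotheses of the set-cover instance, `d`-wise independence and `D ≤ Q` enter only the COUNT of
annoying vectors, `card_annoyingVectors_intBasis_le`, i.e. the probability of the kill event,
`card_not_kill_mul_le`; given the event, the NO-structure is automatic, `noStructure_finBasis`.)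
[cite: Khot2005, Thm. 5.1 (3), Lemma 5.6, §7.2–7.3] -/
theorem base_mem_gapSVP_no {Q : ℤ} (hQ : 1 ≤ Q) (F : S → Finset U) {P : Matrix H Nn ℤ}
    (hP01 : ∀ rr i, P rr i = 0 ∨ P rr i = 1) {s' : H → ℤ} (hs01 : ∀ rr, s' rr = 0 ∨ s' rr = 1)
    {d D : ℕ} (hD : 1 ≤ D)
    {r : (U ⊕ S) ⊕ (H ⊕ Nn) → ℤ} {q : ℤ} (hq : 1 ≤ q) (hr : ∀ i, 0 ≤ r i ∧ r i < q)
    (hkill : ∀ x, Annoying (intBasis Q F P s' *ᵥ x) d D → ¬((q : ℤ) ∣ r ⬝ᵥ (intBasis Q F P s' *ᵥ x)))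
    (e₀ : U) {W : ℤ} (hW : 1 ≤ W) (k : ℕ) (hDk : W ^ 2 * (d : ℤ) ^ (k + 1) ≤ (D : ℤ) ^ 2)
    {T Kpad : ℤ} (hT : 0 ≤ T) (hbT : W ^ 2 * (d : ℤ) ^ (k + 1) ≤ (T + 1) ^ 2)
    (hK : T + growth (augPowMatrix (baseBasis Q F P s' r D q) W k) *
      ((Fintype.card ((U ⊕ S) ⊕ (H ⊕ Nn)) * Q * (4 * Fintype.card S + 3 * Fintype.card Nn + 5) + 1) * T) < Kpad)
    {N : ℕ} (hN : 0 < N) (eR : Out (((U ⊕ S) ⊕ (H ⊕ Nn)) ⊕ Unit) (((S ⊕ (Nn ⊕ H)) ⊕ Unit) ⊕ Unit) k ≃ Fin N)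
    (eC : (Coef (((S ⊕ (Nn ⊕ H)) ⊕ Unit) ⊕ Unit) k ⊕
      {o // augPad (n := ((S ⊕ (Nn ⊕ H)) ⊕ Unit) ⊕ Unit) (basePad (S := S) (H := H) (Nn := Nn) e₀) k o}) ≃ Fin N)
    {γ : ℕ → ℝ} (hγ : 0 ≤ γ N) {τ : ℚ} (hτ : 0 < τ)
    (hlt : (γ N * τ) ^ 2 < ((W ^ 2 * (d : ℤ) ^ (k + 1) : ℤ) : ℝ)) :
    (columnInstance (squareOf (outMatrix (baseBasis Q F P s' r D q) W k (basePad e₀) Kpad) eR eC), τ) ∈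
      GapSVP.no γ := by
  haveI : Nonempty U := ⟨e₀⟩
  have hQ0 : Q ≠ 0 := by omega
  have hD0 : (D : ℤ) ≠ 0 := by exact_mod_cast (show D ≠ 0 by omega)
  have hD1 : (1 : ℤ) ≤ (D : ℤ) := by exact_mod_cast hD
  have hB₀ := baseBasis_mulVec_eq_zero hQ0 F P s' r (D := (D : ℤ)) (q := q) hD0 (by omega)
  have hNO : NoStructure (baseBasis Q F P s' r D q) d D :=
    noStructure_finBasis (intBasis_mulVec_eq_zero hQ0 F P s') (by omega) hkill
  have hrec := recoverable_finBasis_intBasis hQ F hP01 hs01 hq hr hD1 e₀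
  have hc₁ : (0 : ℤ) ≤ Fintype.card ((U ⊕ S) ⊕ (H ⊕ Nn)) * Q * (4 * Fintype.card S + 3 * Fintype.card Nn + 5) + 1 := by
    positivity
  exact outMatrix_mem_gapSVP_no hB₀ hNO hc₁ hrec hW k hDk hT hbT hK hN eR eC hγ hτ hlt

/-- **YES side for Khot's base** (Thm. 3.1 (3) + Lemma 4.3 + Lemma 5.4 + Lemma 5.7 event ⇒
Lemma 7.1 ⇒ gap instance): given an exact cover `T` (`B_cvp 1_T - t = 0 ∘ 1_T`), `{0,1}`-data
`P, s'`, a good index set `J` (`J ∈ goodSets P s' rr`) whose good vector SURVIVES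
(`q ∣ r·(good vector)`), `1 ≤ Q`, `1 ≤ D`, `1 ≤ q`, `r` with entries in `[0,q)`, and the numeric
side conditions (`g = 4|T| + rr ≥ 2`, `s = |T| + rr + h·rr² + 1 + g²`, `s^k ≤ W²`, `Kpad ≠ 0`,
`2W²g^{k+1} ≤ τ²`), the output instance is a YES instance of `GapSVP_γ`.
[cite: Khot2005, Thm. 5.1 (2), Lemma 5.7, §7.1, §7.3] -/
theorem base_mem_gapSVP_yes {Q : ℤ} (hQ : 1 ≤ Q) {F : S → Finset U} {P : Matrix H Nn ℤ}
    (hP01 : ∀ rr i, P rr i = 0 ∨ P rr i = 1) {s' : H → ℤ} (hs01 : ∀ rr, s' rr = 0 ∨ s' rr = 1)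
    {T : Finset S} (hT : cvpBasis Q F *ᵥ indicator T - cvpTarget Q = Sum.elim (0 : U → ℤ) (indicator T))
    {rr : ℕ} {J : Finset Nn} (hJ : J ∈ goodSets P s' rr)
    {r : (U ⊕ S) ⊕ (H ⊕ Nn) → ℤ} {q : ℤ} (hq : 1 ≤ q) (hr : ∀ i, 0 ≤ r i ∧ r i < q)
    (hsurv : (q : ℤ) ∣ r ⬝ᵥ goodVector Q F P s' T J) {D : ℤ} (hD : 1 ≤ D) (e₀ : U)
    {W : ℤ} (hW : 1 ≤ W) (k : ℕ) {g s : ℤ} (hgdef : g = 4 * T.card + rr)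
    (hg2 : 2 ≤ g) (hsdef : s = T.card + (rr + Fintype.card H * (rr : ℤ) ^ 2) + 1 + g ^ 2)
    (hsW : s ^ k ≤ W ^ 2) {Kpad : ℤ} (hKpad : Kpad ≠ 0)
    {N : ℕ} (eR : Out (((U ⊕ S) ⊕ (H ⊕ Nn)) ⊕ Unit) (((S ⊕ (Nn ⊕ H)) ⊕ Unit) ⊕ Unit) k ≃ Fin N)
    (eC : (Coef (((S ⊕ (Nn ⊕ H)) ⊕ Unit) ⊕ Unit) k ⊕
      {o // augPad (n := ((S ⊕ (Nn ⊕ H)) ⊕ Unit) ⊕ Unit) (basePad (S := S) (H := H) (Nn := Nn) e₀) k o}) ≃ Fin N)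
    (γ : ℕ → ℝ) {τ : ℚ} (hτ : 0 < τ) (hle : ((2 * W ^ 2 * g ^ (k + 1) : ℤ) : ℝ) ≤ (τ : ℝ) ^ 2) :
    (columnInstance (squareOf (outMatrix (baseBasis Q F P s' r D q) W k (basePad e₀) Kpad) eR eC), τ) ∈
      GapSVP.yes γ := by
  haveI : Nonempty U := ⟨e₀⟩
  have hQ0 : Q ≠ 0 := by omega
  have hB₀ := baseBasis_mulVec_eq_zero hQ0 F P s' r (D := D) (q := q) (by omega) (by omega)
  have hrec := recoverable_finBasis_intBasis hQ F hP01 hs01 hq hr hD e₀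
  -- the YES data of the surviving good vector
  obtain ⟨hJcard, hJpar⟩ := mem_goodSets.1 hJ
  obtain ⟨h012, hnorm, hcoef⟩ := goodVector_data (Q := Q) (F := F) hP01 hs01 hT hJpar
  have hxne : intCoeff (indicator T) (indicator J) (goodY P s' J) (-1) ≠ 0 := by
    intro h0
    have := congrFun h0 (Sum.inr ())
    simp [intCoeff] at this
  obtain ⟨l₀, -, -, -, hx'ne, hg', hs'⟩ := yes_finBasis (intBasis Q F P s') (by omega : (0 : ℤ) < q) hr D
    hxne h012 hsurv (le_of_eq hnorm) hcoef
  have hs'' : intSqNorm (Sum.elim (intCoeff (indicator T) (indicator J) (goodY P s' J) (-1))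
      fun _ : Unit => -l₀) ≤ s := by
    rw [hsdef, hgdef, ← hJcard]; exact hs'
  have hg'' : intSqNorm (baseBasis Q F P s' r D q *ᵥ
      Sum.elim (intCoeff (indicator T) (indicator J) (goodY P s' J) (-1)) fun _ : Unit => -l₀) ≤ g := by
    rw [hgdef, ← hJcard]; exact hg'
  exact outMatrix_mem_gapSVP_yes hB₀ hrec hW hg2 hx'ne hs'' hg'' k hsW hKpad eR eC γ hτ hle

end Base


section RowVectors

variable {U S H Nn : Type} [Fintype U] [Fintype S] [Fintype H] [Fintype Nn]
variable [DecidableEq U] [DecidableEq S] [DecidableEq H] [DecidableEq Nn]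

/-- The base distortion constant of `recoverable_finBasis_intBasis`. [folklore] -/
def baseC₁ (U S H Nn : Type) [Fintype U] [Fintype S] [Fintype H] [Fintype Nn] (Q : ℤ) : ℤ :=
  Fintype.card ((U ⊕ S) ⊕ (H ⊕ Nn)) * Q * (4 * Fintype.card S + 3 * Fintype.card Nn + 5) + 1

/-- **The instance output by Khot's reduction** for given deterministic data (`Q, F, P, s', D, q,
W, k, T, τ`, the equivalences to `Fin N`) and the random row vector `r ∈ (ℤ/q)^{rows}` (§5.2.2:
"each of which is chosen randomly from the range `[0, q-1]`"): the base basis with `liftRow r`,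
boosted `k` times, padded with `Kpad = T + growth·c₁·T + 1` (computed from the sampled data),
reindexed, read by columns, with threshold `τ`. [cite: Khot2005, §5.2.2 and §7.3] -/
def khotInstance (Q : ℤ) (F : S → Finset U) (P : Matrix H Nn ℤ) (s' : H → ℤ) (D : ℤ) (q : ℕ)
    (e₀ : U) (W : ℤ) (k : ℕ) (T : ℤ) (τ : ℚ) {N : ℕ}
    (eR : Out (((U ⊕ S) ⊕ (H ⊕ Nn)) ⊕ Unit) (((S ⊕ (Nn ⊕ H)) ⊕ Unit) ⊕ Unit) k ≃ Fin N)
    (eC : (Coef (((S ⊕ (Nn ⊕ H)) ⊕ Unit) ⊕ Unit) k ⊕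
      {o // augPad (n := ((S ⊕ (Nn ⊕ H)) ⊕ Unit) ⊕ Unit) (basePad (S := S) (H := H) (Nn := Nn) e₀) k o}) ≃ Fin N)
    (r : (U ⊕ S) ⊕ (H ⊕ Nn) → ZMod q) : GapSVPInstance :=
  let B₀ := baseBasis Q F P s' (liftRow r) D q
  (columnInstance (squareOf (outMatrix B₀ W k (basePad e₀)
    (T + growth (augPowMatrix B₀ W k) * (baseC₁ U S H Nn Q * T) + 1)) eR eC), τ)

variable {q : ℕ} [NeZero q]

open Classical in
/-- **NO side, probability of failure** (Lemma 5.6 ⇒ Thm. 5.1 (3) ⇒ Lemma 7.2 ⇒ NO instance):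
in the NO case, if `100 · #A · D ≤ q` (`#A` = number of annoying vectors of the intermediate
lattice; printed: prime `q ≥ 100·#A`), then at most a `1/100` fraction of the row vectors `r`
yield an instance outside `GapSVP.no γ`: `100 · #{bad r} ≤ q^{rows}` — "with probability at
least `9/10`" in print (here `99/100` for this event alone). Hypotheses: `Q ≥ 1`, `1 ≤ D`,
`{0,1}`-data `P, s'`, and the numeric side conditions of the boosting/padding/threshold
(`W ≥ 1`, `W²d^{k+1} ≤ D²`, `0 ≤ T`, `W²d^{k+1} ≤ (T+1)²`, `N ≥ 1`, `τ > 0`,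
`(γ(N)τ)² < W²d^{k+1}`, `γ(N) ≥ 0`). [cite: Khot2005, Thm. 5.1 (3) and Lemma 5.6] -/
theorem card_bad_no_le {Q : ℤ} (hQ : 1 ≤ Q) (F : S → Finset U) {P : Matrix H Nn ℤ}
    (hP01 : ∀ rr i, P rr i = 0 ∨ P rr i = 1) {s' : H → ℤ} (hs01 : ∀ rr, s' rr = 0 ∨ s' rr = 1)
    {d D : ℕ} (hD : 1 ≤ D) (hq : 100 * #(annoyingVectors (intBasis Q F P s') d D) * D ≤ q)
    (e₀ : U) {W : ℤ} (hW : 1 ≤ W) (k : ℕ) (hDk : W ^ 2 * (d : ℤ) ^ (k + 1) ≤ (D : ℤ) ^ 2)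
    {T : ℤ} (hT : 0 ≤ T) (hbT : W ^ 2 * (d : ℤ) ^ (k + 1) ≤ (T + 1) ^ 2)
    {N : ℕ} (hN : 0 < N) (eR : Out (((U ⊕ S) ⊕ (H ⊕ Nn)) ⊕ Unit) (((S ⊕ (Nn ⊕ H)) ⊕ Unit) ⊕ Unit) k ≃ Fin N)
    (eC : (Coef (((S ⊕ (Nn ⊕ H)) ⊕ Unit) ⊕ Unit) k ⊕
      {o // augPad (n := ((S ⊕ (Nn ⊕ H)) ⊕ Unit) ⊕ Unit) (basePad (S := S) (H := H) (Nn := Nn) e₀) k o}) ≃ Fin N)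
    {γ : ℕ → ℝ} (hγ : 0 ≤ γ N) {τ : ℚ} (hτ : 0 < τ)
    (hlt : (γ N * τ) ^ 2 < ((W ^ 2 * (d : ℤ) ^ (k + 1) : ℤ) : ℝ)) :
    100 * #((univ : Finset ((U ⊕ S) ⊕ (H ⊕ Nn) → ZMod q)).filter fun r =>
        khotInstance Q F P s' D q e₀ W k T τ eR eC r ∉ GapSVP.no γ) ≤
      q ^ Fintype.card ((U ⊕ S) ⊕ (H ⊕ Nn)) := by
  classical
  -- a bad `r` fails to kill some annoying vector
  have hsub : ((univ : Finset ((U ⊕ S) ⊕ (H ⊕ Nn) → ZMod q)).filter fun r =>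
        khotInstance Q F P s' D q e₀ W k T τ eR eC r ∉ GapSVP.no γ) ⊆
      univ.filter fun r => ∃ x, Annoying (intBasis Q F P s' *ᵥ x) d D ∧
        r ⬝ᵥ residues q (intBasis Q F P s' *ᵥ x) = 0 := by
    intro r hr
    refine mem_filter.2 ⟨mem_univ _, ?_⟩
    by_contra hgood
    push Not at hgood
    refine (mem_filter.1 hr).2 ?_
    have hkill : ∀ x, Annoying (intBasis Q F P s' *ᵥ x) d D →
        ¬((q : ℤ) ∣ liftRow r ⬝ᵥ (intBasis Q F P s' *ᵥ x)) := fun x hA hdvd =>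
      hgood x hA ((dvd_liftRow_dotProduct_iff r _).1 hdvd)
    have hq1 : (1 : ℤ) ≤ q := by
      have : 0 < q := Nat.pos_of_ne_zero (NeZero.ne q)
      exact_mod_cast this
    exact base_mem_gapSVP_no hQ F hP01 hs01 hD hq1 (liftRow_range r) hkill e₀ hW k hDk hT hbT
      (lt_add_one _) hN eR eC hγ hτ hlt
  have h1 := card_not_kill_mul_le (q := q) (intBasis Q F P s') d D
  have h2 : #((univ : Finset ((U ⊕ S) ⊕ (H ⊕ Nn) → ZMod q)).filter fun r =>
        khotInstance Q F P s' D q e₀ W k T τ eR eC r ∉ GapSVP.no γ) * q ≤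
      #(annoyingVectors (intBasis Q F P s') d D) * (q ^ Fintype.card ((U ⊕ S) ⊕ (H ⊕ Nn)) * D) :=
    (Nat.mul_le_mul_right q (card_le_card hsub)).trans h1
  have hqpos : 0 < q := Nat.pos_of_ne_zero (NeZero.ne q)
  -- `100·#bad·q ≤ 100·#A·D·q^{rows} ≤ q·q^{rows}`
  have h3 : 100 * #((univ : Finset ((U ⊕ S) ⊕ (H ⊕ Nn) → ZMod q)).filter fun r =>
        khotInstance Q F P s' D q e₀ W k T τ eR eC r ∉ GapSVP.no γ) * q ≤
      q ^ Fintype.card ((U ⊕ S) ⊕ (H ⊕ Nn)) * q := by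
    calc 100 * #((univ : Finset ((U ⊕ S) ⊕ (H ⊕ Nn) → ZMod q)).filter fun r =>
          khotInstance Q F P s' D q e₀ W k T τ eR eC r ∉ GapSVP.no γ) * q
        ≤ 100 * (#(annoyingVectors (intBasis Q F P s') d D) * (q ^ Fintype.card ((U ⊕ S) ⊕ (H ⊕ Nn)) * D)) := by
          rw [mul_assoc]; exact Nat.mul_le_mul_left 100 h2
      _ = (100 * #(annoyingVectors (intBasis Q F P s') d D) * D) * q ^ Fintype.card ((U ⊕ S) ⊕ (H ⊕ Nn)) := by ring
      _ ≤ q * q ^ Fintype.card ((U ⊕ S) ⊕ (H ⊕ Nn)) := Nat.mul_le_mul_right _ hq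
      _ = q ^ Fintype.card ((U ⊕ S) ⊕ (H ⊕ Nn)) * q := mul_comm _ _
  exact Nat.le_of_mul_le_mul_right h3 hqpos

open Classical in
/-- **YES side, probability of failure** (Lemma 5.7 ⇒ Thm. 5.1 (2) ⇒ Lemma 7.1 ⇒ YES instance):
in the YES case (exact cover `T₀`, good shift `s'` with `K_{s'} = #goodSets P s' rr` good index
sets of size `rr ≥ 1`), the row vectors `r` yielding an instance outside `GapSVP.yes γ` are among
those for which no good vector survives, so `#{bad r} · K_{s'} ≤ q^{rows+1}` — at most a `q/K_{s'}`
fraction (`≤ 1/100` for `K_{s'} ≥ 100q`; printed "with probability at least `9/10`").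
Hypotheses: `Q ≥ 1`, `1 ≤ D`, `{0,1}`-data, and the numeric side conditions
(`g = 4|T₀| + rr ≥ 2`, `s = |T₀| + rr + h rr² + 1 + g²`, `s^k ≤ W²`, `W ≥ 1`, `0 ≤ T`, `τ > 0`,
`2W²g^{k+1} ≤ τ²`). [cite: Khot2005, Thm. 5.1 (2) and Lemma 5.7] -/
theorem card_bad_yes_mul_le {Q : ℤ} (hQ : 1 ≤ Q) {F : S → Finset U} {P : Matrix H Nn ℤ}
    (hP01 : ∀ rr i, P rr i = 0 ∨ P rr i = 1) {s' : H → ℤ} (hs01 : ∀ rr, s' rr = 0 ∨ s' rr = 1)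
    {T₀ : Finset S} (hT₀ : cvpBasis Q F *ᵥ indicator T₀ - cvpTarget Q = Sum.elim (0 : U → ℤ) (indicator T₀))
    {rr : ℕ} (hrr : 1 ≤ rr) {D : ℤ} (hD : 1 ≤ D) (e₀ : U) {W : ℤ} (hW : 1 ≤ W) (k : ℕ)
    {g s : ℤ} (hgdef : g = 4 * T₀.card + rr) (hg2 : 2 ≤ g)
    (hsdef : s = T₀.card + (rr + Fintype.card H * (rr : ℤ) ^ 2) + 1 + g ^ 2) (hsW : s ^ k ≤ W ^ 2)
    {T : ℤ} (hT : 0 ≤ T)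
    {N : ℕ} (eR : Out (((U ⊕ S) ⊕ (H ⊕ Nn)) ⊕ Unit) (((S ⊕ (Nn ⊕ H)) ⊕ Unit) ⊕ Unit) k ≃ Fin N)
    (eC : (Coef (((S ⊕ (Nn ⊕ H)) ⊕ Unit) ⊕ Unit) k ⊕
      {o // augPad (n := ((S ⊕ (Nn ⊕ H)) ⊕ Unit) ⊕ Unit) (basePad (S := S) (H := H) (Nn := Nn) e₀) k o}) ≃ Fin N)
    (γ : ℕ → ℝ) {τ : ℚ} (hτ : 0 < τ) (hle : ((2 * W ^ 2 * g ^ (k + 1) : ℤ) : ℝ) ≤ (τ : ℝ) ^ 2) :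
    #((univ : Finset ((U ⊕ S) ⊕ (H ⊕ Nn) → ZMod q)).filter fun r =>
        khotInstance Q F P s' D q e₀ W k T τ eR eC r ∉ GapSVP.yes γ) * #(goodSets P s' rr) ≤
      q ^ Fintype.card ((U ⊕ S) ⊕ (H ⊕ Nn)) * q := by
  classical
  have hsub : ((univ : Finset ((U ⊕ S) ⊕ (H ⊕ Nn) → ZMod q)).filter fun r =>
        khotInstance Q F P s' D q e₀ W k T τ eR eC r ∉ GapSVP.yes γ) ⊆
      univ.filter fun r => ∀ J ∈ goodSets P s' rr, r ⬝ᵥ residues q (goodVector Q F P s' T₀ J) ≠ 0 := by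
    intro r hr
    refine mem_filter.2 ⟨mem_univ _, fun J hJ h0 => (mem_filter.1 hr).2 ?_⟩
    have hsurv : (q : ℤ) ∣ liftRow r ⬝ᵥ goodVector Q F P s' T₀ J := (dvd_liftRow_dotProduct_iff r _).2 h0
    have hq1 : (1 : ℤ) ≤ q := by
      have : 0 < q := Nat.pos_of_ne_zero (NeZero.ne q)
      exact_mod_cast this
    have hKpad : T + growth (augPowMatrix (baseBasis Q F P s' (liftRow r) D q) W k) *
        (baseC₁ U S H Nn Q * T) + 1 ≠ 0 := by
      have h0 : 0 ≤ growth (augPowMatrix (baseBasis Q F P s' (liftRow r) D q) W k) * (baseC₁ U S H Nn Q * T) :=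
        mul_nonneg (Finset.sum_nonneg fun _ _ => Finset.sum_nonneg fun _ _ => abs_nonneg _)
          (mul_nonneg (by unfold baseC₁; positivity) hT)
      intro h; linarith
    exact base_mem_gapSVP_yes hQ hP01 hs01 hT₀ hJ hq1 (liftRow_range r) hsurv hD e₀ hW k hgdef hg2
      hsdef hsW hKpad eR eC γ hτ hle
  refine le_trans (Nat.mul_le_mul_right _ (card_le_card hsub)) ?_
  have h := card_no_good_survivor_mul_le (q := q) (Q := Q) (F := F) hP01 hs01 hT₀ hrr
  convert h using 2

end RowVectors


section Shift

variable {H Nn : Type} [Fintype H] [Fintype Nn] [DecidableEq H] [DecidableEq Nn]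

/-- The `GF(2)` column-sum (parity vector) of the columns of `P` indexed by `J`:
`row ↦ (P·1_J)_row mod 2` (Lemma 4.3: "sum them up over `GF(2)`"). [cite: Khot2005, Lemma 4.3 (proof)] -/
def parityVec (P : Matrix H Nn ℤ) (J : Finset Nn) : H → ZMod 2 :=
  fun row => ((P *ᵥ indicator J) row : ZMod 2)

/-- **The sampled shift** (Lemma 4.3: "Pick `r` columns of the matrix `P_BCH` at random and
define `s` to be their sum"): for a tuple `g` of column indices, `s'_row ∈ {0,1}` is the parity
of `(P·1_{im g})_row`. [cite: Khot2005, Lemma 4.3 (proof)] -/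
def tupleShift (P : Matrix H Nn ℤ) {rr : ℕ} (g : Fin rr → Nn) : H → ℤ :=
  fun row => (P *ᵥ indicator ((univ : Finset (Fin rr)).image g)) row % 2

omit [Fintype H] [DecidableEq H] in
/-- The sampled shift is `{0,1}`-valued. [cite: Khot2005, Lemma 4.3 (proof)] -/
theorem tupleShift_01 (P : Matrix H Nn ℤ) {rr : ℕ} (g : Fin rr → Nn) (row : H) :
    tupleShift P g row = 0 ∨ tupleShift P g row = 1 :=
  Int.emod_two_eq_zero_or_one _

omit [Fintype H] [DecidableEq H] in
/-- The good index sets for the sampled shift are exactly the `rr`-sets with the same parity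
vector as the image of the tuple (`ColParityOK P (tupleShift P g) J ↔ parityVec P J =
parityVec P (im g)`). [cite: Khot2005, Lemma 4.3 (proof)] -/
theorem colParityOK_tupleShift_iff (P : Matrix H Nn ℤ) {rr : ℕ} (g : Fin rr → Nn) (J : Finset Nn) :
    ColParityOK P (tupleShift P g) J ↔ parityVec P J = parityVec P ((univ : Finset (Fin rr)).image g) := by
  simp only [ColParityOK, tupleShift, parityVec, funext_iff]
  refine forall_congr' fun row => ?_
  rw [Int.even_iff, ZMod.intCast_eq_intCast_iff']
  simp only [Nat.cast_ofNat]
  omega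

omit [Fintype H] [DecidableEq H] in
/-- Hence `goodSets P (tupleShift P g) rr` is the fibre of `parityVec P` over the `rr`-subsets
through the parity vector of `im g`. [cite: Khot2005, Lemma 4.3 (proof)] -/
theorem mem_goodSets_tupleShift_iff (P : Matrix H Nn ℤ) {rr : ℕ} (g : Fin rr → Nn) (J : Finset Nn) :
    J ∈ goodSets P (tupleShift P g) rr ↔
      J.card = rr ∧ parityVec P J = parityVec P ((univ : Finset (Fin rr)).image g) := by
  rw [mem_goodSets, colParityOK_tupleShift_iff]

omit [DecidableEq H] in
/-- **`K_s` from the tuple count** (Lemma 4.3 with the tuple-to-set loss): the INJECTIVE tuples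
with the same parity vector as `g` have images in `goodSets P (tupleShift P g) rr`, at most
`rr^rr` per image (`card_mul_pow_ge_of_image`), so
`#{g' injective, same parity vector} ≤ rr^rr · K_{s'}`. [cite: Khot2005, Lemma 4.3] -/
theorem card_sameParity_inj_le (P : Matrix H Nn ℤ) {rr : ℕ} (g : Fin rr → Nn) :
    #((univ : Finset (Fin rr → Nn)).filter fun g' => Function.Injective g' ∧
        parityVec P ((univ : Finset (Fin rr)).image g') = parityVec P ((univ : Finset (Fin rr)).image g)) ≤
      rr ^ rr * #(goodSets P (tupleShift P g) rr) := by
  classical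
  set G := (univ : Finset (Fin rr → Nn)).filter fun g' => Function.Injective g' ∧
    parityVec P ((univ : Finset (Fin rr)).image g') = parityVec P ((univ : Finset (Fin rr)).image g)
  have himg : ∀ g' ∈ G, #((univ : Finset (Fin rr)).image g') ≤ rr :=
    fun g' _ => Finset.card_image_le.trans (by rw [Finset.card_univ, Fintype.card_fin])
  refine (card_mul_pow_ge_of_image rr G himg).trans (Nat.mul_le_mul_left _ (card_le_card fun J hJ => ?_))
  obtain ⟨g', hg', rfl⟩ := mem_image.1 hJ
  obtain ⟨hinj, hsame⟩ := (mem_filter.1 hg').2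
  refine (mem_goodSets_tupleShift_iff P g _).2 ⟨?_, hsame⟩
  rw [Finset.card_image_of_injective _ hinj, Finset.card_univ, Fintype.card_fin]

/-- **Lemma 4.3 for injective tuples**: among the injective tuples, at most `2ʰ · B` have a
parity vector shared by fewer than `B` injective tuples (`card_filter_small_fibre_le` on the set
of injective tuples with `β = GF(2)ʰ`). [cite: Khot2005, Lemma 4.3] -/
theorem card_smallParity_inj_le (P : Matrix H Nn ℤ) (rr B : ℕ) :
    #(((univ : Finset (Fin rr → Nn)).filter fun g => Function.Injective g).filter fun g =>
        #(((univ : Finset (Fin rr → Nn)).filter fun g' => Function.Injective g').filter fun g' =>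
          parityVec P ((univ : Finset (Fin rr)).image g') = parityVec P ((univ : Finset (Fin rr)).image g)) < B) ≤
      2 ^ Fintype.card H * B := by
  classical
  have h := card_filter_small_fibre_le ((univ : Finset (Fin rr → Nn)).filter fun g => Function.Injective g)
    (fun g => parityVec P ((univ : Finset (Fin rr)).image g)) B
  rw [Fintype.card_pi, Finset.prod_const, ZMod.card, Finset.card_univ] at h
  exact h

end Shift

/-! ### The total error over (tuple, row vector) -/

section Total

variable {U S H Nn : Type} [Fintype U] [Fintype S] [Fintype H] [Fintype Nn]
variable [DecidableEq U] [DecidableEq S] [DecidableEq H] [DecidableEq Nn]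
variable {q : ℕ} [NeZero q]

/-- Counting a subset of a product type fibrewise over the first factor. [folklore] -/
theorem card_filter_prod_eq_sum {α β : Type} [Fintype α] [Fintype β] (p : α × β → Prop)
    [DecidablePred p] :
    #((univ : Finset (α × β)).filter p) = ∑ a, #((univ : Finset β).filter fun b => p (a, b)) := by
  classical
  rw [Finset.card_filter, Fintype.sum_prod_type]
  refine Finset.sum_congr rfl fun a _ => ?_
  rw [Finset.card_filter]

open Classical in
/-- **NO case, total error over `(g, r)`** (Thm. 5.1 (3) for the sampled data): if for every
sampled shift the modulus satisfies `100·#A·D ≤ q`, then at most a `1/100` fraction of the pairs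
(tuple of columns, row vector) yield an instance outside `GapSVP.no γ`:
`100 · #{bad (g, r)} ≤ |Nn|^{rr} · q^{rows}`. [cite: Khot2005, Thm. 5.1 (3)] -/
theorem card_bad_no_total_le {Q : ℤ} (hQ : 1 ≤ Q) (F : S → Finset U) {P : Matrix H Nn ℤ}
    (hP01 : ∀ rr i, P rr i = 0 ∨ P rr i = 1) (rr : ℕ) {d D : ℕ} (hD : 1 ≤ D)
    (hq : ∀ g : Fin rr → Nn, 100 * #(annoyingVectors (intBasis Q F P (tupleShift P g)) d D) * D ≤ q)
    (e₀ : U) {W : ℤ} (hW : 1 ≤ W) (k : ℕ) (hDk : W ^ 2 * (d : ℤ) ^ (k + 1) ≤ (D : ℤ) ^ 2)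
    {T : ℤ} (hT : 0 ≤ T) (hbT : W ^ 2 * (d : ℤ) ^ (k + 1) ≤ (T + 1) ^ 2)
    {N : ℕ} (hN : 0 < N) (eR : Out (((U ⊕ S) ⊕ (H ⊕ Nn)) ⊕ Unit) (((S ⊕ (Nn ⊕ H)) ⊕ Unit) ⊕ Unit) k ≃ Fin N)
    (eC : (Coef (((S ⊕ (Nn ⊕ H)) ⊕ Unit) ⊕ Unit) k ⊕
      {o // augPad (n := ((S ⊕ (Nn ⊕ H)) ⊕ Unit) ⊕ Unit) (basePad (S := S) (H := H) (Nn := Nn) e₀) k o}) ≃ Fin N)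
    {γ : ℕ → ℝ} (hγ : 0 ≤ γ N) {τ : ℚ} (hτ : 0 < τ)
    (hlt : (γ N * τ) ^ 2 < ((W ^ 2 * (d : ℤ) ^ (k + 1) : ℤ) : ℝ)) :
    100 * #((univ : Finset ((Fin rr → Nn) × ((U ⊕ S) ⊕ (H ⊕ Nn) → ZMod q))).filter fun ω =>
        khotInstance Q F P (tupleShift P ω.1) D q e₀ W k T τ eR eC ω.2 ∉ GapSVP.no γ) ≤
      Fintype.card Nn ^ rr * q ^ Fintype.card ((U ⊕ S) ⊕ (H ⊕ Nn)) := by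
  classical
  rw [card_filter_prod_eq_sum, Finset.mul_sum]
  calc ∑ g : Fin rr → Nn, 100 * #((univ : Finset ((U ⊕ S) ⊕ (H ⊕ Nn) → ZMod q)).filter fun r =>
          khotInstance Q F P (tupleShift P g) D q e₀ W k T τ eR eC r ∉ GapSVP.no γ)
      ≤ ∑ _g : Fin rr → Nn, q ^ Fintype.card ((U ⊕ S) ⊕ (H ⊕ Nn)) :=
        Finset.sum_le_sum fun g _ => by
          convert card_bad_no_le (q := q) hQ F hP01 (tupleShift_01 P g) hD (hq g) e₀ hW k hDk hT hbT hN
            eR eC hγ hτ hlt using 4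
    _ = Fintype.card Nn ^ rr * q ^ Fintype.card ((U ⊕ S) ⊕ (H ⊕ Nn)) := by
        rw [Finset.sum_const, smul_eq_mul, Finset.card_univ, Fintype.card_fun, Fintype.card_fin]

open Classical in
/-- **YES case, total error over `(g, r)`** (Lemma 4.3 + Thm. 5.1 (2) for the sampled data): in
the YES case (exact cover `T₀`), if the sampling conditions hold — the collision-or-small-fibre
tuples are at most a `1/100` fraction, `100·(C + 2ʰB') ≤ |Nn|^{rr}` with `C` the number of
non-injective tuples (fibres taken among injective tuples), and a large fibre yields `≥ 100q`
good sets, `100·q·rr^{rr} ≤ B'` —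
then at most a `2/100` fraction of the pairs yield an instance outside `GapSVP.yes γ`:
`100 · #{bad (g, r)} ≤ 2 · |Nn|^{rr} · q^{rows}`. [cite: Khot2005, Lemma 4.3 and Thm. 5.1 (2)] -/
theorem card_bad_yes_total_le {Q : ℤ} (hQ : 1 ≤ Q) {F : S → Finset U} {P : Matrix H Nn ℤ}
    (hP01 : ∀ rr i, P rr i = 0 ∨ P rr i = 1)
    {T₀ : Finset S} (hT₀ : cvpBasis Q F *ᵥ indicator T₀ - cvpTarget Q = Sum.elim (0 : U → ℤ) (indicator T₀))
    {rr : ℕ} (hrr : 1 ≤ rr) {B' : ℕ}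
    (hS1 : 100 * (#((univ : Finset (Fin rr → Nn)).filter fun g => ¬Function.Injective g) +
      2 ^ Fintype.card H * B') ≤ Fintype.card Nn ^ rr)
    (hS2 : 100 * q * rr ^ rr ≤ B')
    {D : ℤ} (hD : 1 ≤ D) (e₀ : U) {W : ℤ} (hW : 1 ≤ W) (k : ℕ)
    {g₀ s : ℤ} (hgdef : g₀ = 4 * T₀.card + rr) (hg2 : 2 ≤ g₀)
    (hsdef : s = T₀.card + (rr + Fintype.card H * (rr : ℤ) ^ 2) + 1 + g₀ ^ 2) (hsW : s ^ k ≤ W ^ 2)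
    {T : ℤ} (hT : 0 ≤ T)
    {N : ℕ} (eR : Out (((U ⊕ S) ⊕ (H ⊕ Nn)) ⊕ Unit) (((S ⊕ (Nn ⊕ H)) ⊕ Unit) ⊕ Unit) k ≃ Fin N)
    (eC : (Coef (((S ⊕ (Nn ⊕ H)) ⊕ Unit) ⊕ Unit) k ⊕
      {o // augPad (n := ((S ⊕ (Nn ⊕ H)) ⊕ Unit) ⊕ Unit) (basePad (S := S) (H := H) (Nn := Nn) e₀) k o}) ≃ Fin N)
    (γ : ℕ → ℝ) {τ : ℚ} (hτ : 0 < τ) (hle : ((2 * W ^ 2 * g₀ ^ (k + 1) : ℤ) : ℝ) ≤ (τ : ℝ) ^ 2) :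
    100 * #((univ : Finset ((Fin rr → Nn) × ((U ⊕ S) ⊕ (H ⊕ Nn) → ZMod q))).filter fun ω =>
        khotInstance Q F P (tupleShift P ω.1) D q e₀ W k T τ eR eC ω.2 ∉ GapSVP.yes γ) ≤
      2 * (Fintype.card Nn ^ rr * q ^ Fintype.card ((U ⊕ S) ⊕ (H ⊕ Nn))) := by
  classical
  set rows := Fintype.card ((U ⊕ S) ⊕ (H ⊕ Nn)) with hrows
  set C := #((univ : Finset (Fin rr → Nn)).filter fun g => ¬Function.Injective g) with hC
  set fib : (Fin rr → Nn) → ℕ := fun g => #(((univ : Finset (Fin rr → Nn)).filter fun g' =>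
    Function.Injective g').filter fun g' =>
      parityVec P ((univ : Finset (Fin rr)).image g') = parityVec P ((univ : Finset (Fin rr)).image g)) with hfib
  set Gbad := (univ : Finset (Fin rr → Nn)).filter fun g => ¬Function.Injective g ∨ fib g < B' with hGbad
  set badr : (Fin rr → Nn) → ℕ := fun g => #((univ : Finset ((U ⊕ S) ⊕ (H ⊕ Nn) → ZMod q)).filter fun r =>
    khotInstance Q F P (tupleShift P g) D q e₀ W k T τ eR eC r ∉ GapSVP.yes γ) with hbadr
  have hqpos : 0 < q := Nat.pos_of_ne_zero (NeZero.ne q)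
  -- bound for a good `g`
  have hgood : ∀ g, g ∉ Gbad → 100 * badr g ≤ q ^ rows := by
    intro g hg
    have hng : ¬(¬Function.Injective g ∨ fib g < B') := fun h => hg (mem_filter.2 ⟨mem_univ _, h⟩)
    have hg' : Function.Injective g ∧ B' ≤ fib g := by
      constructor
      · by_contra h; exact hng (Or.inl h)
      · by_contra h; push Not at h; exact hng (Or.inr h)
    -- `K ≥ 100 q`
    have hK : 100 * q ≤ #(goodSets P (tupleShift P g) rr) := by
      have h1 := card_sameParity_inj_le P g
      have hfibeq : fib g = #((univ : Finset (Fin rr → Nn)).filter fun g' => Function.Injective g' ∧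
          parityVec P ((univ : Finset (Fin rr)).image g') = parityVec P ((univ : Finset (Fin rr)).image g)) := by
        simp only [hfib, Finset.filter_filter]
      have h2 : 100 * q * rr ^ rr ≤ rr ^ rr * #(goodSets P (tupleShift P g) rr) :=
        hS2.trans ((hfibeq ▸ hg'.2).trans h1)
      rw [mul_comm (rr ^ rr)] at h2
      exact Nat.le_of_mul_le_mul_right h2 (pow_pos (by omega) rr)
    have h3 := card_bad_yes_mul_le (q := q) hQ hP01 (tupleShift_01 P g) hT₀ hrr hD e₀ hW k hgdef hg2 hsdef hsW hT
      eR eC γ hτ hle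
    -- `badr g * (100 q) ≤ badr g * K ≤ q^rows q`
    have h4 : badr g * (100 * q) ≤ q ^ rows * q := (Nat.mul_le_mul_left _ hK).trans h3
    have h5 : 100 * badr g * q ≤ q ^ rows * q := by
      calc 100 * badr g * q = badr g * (100 * q) := by ring
        _ ≤ q ^ rows * q := h4
    exact Nat.le_of_mul_le_mul_right h5 hqpos
  -- bound for the bad `g`
  have hGbad_card : 100 * #Gbad ≤ Fintype.card Nn ^ rr := by
    -- a bad tuple is non-injective, or injective in a small fibre
    have h1 : #Gbad ≤ C + #(((univ : Finset (Fin rr → Nn)).filter fun g => Function.Injective g).filter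
        fun g => fib g < B') := by
      have hsub : Gbad ⊆ ((univ : Finset (Fin rr → Nn)).filter fun g => ¬Function.Injective g) ∪
          (((univ : Finset (Fin rr → Nn)).filter fun g => Function.Injective g).filter fun g => fib g < B') := by
        intro g hg
        rcases (mem_filter.1 hg).2 with h | h
        · exact mem_union_left _ (mem_filter.2 ⟨mem_univ _, h⟩)
        · by_cases hi : Function.Injective g
          · exact mem_union_right _ (mem_filter.2 ⟨mem_filter.2 ⟨mem_univ _, hi⟩, h⟩)
          · exact mem_union_left _ (mem_filter.2 ⟨mem_univ _, hi⟩)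
      exact (card_le_card hsub).trans (Finset.card_union_le _ _)
    have h2 : #(((univ : Finset (Fin rr → Nn)).filter fun g => Function.Injective g).filter
        fun g => fib g < B') ≤ 2 ^ Fintype.card H * B' := card_smallParity_inj_le P rr B'
    calc 100 * #Gbad ≤ 100 * (C + 2 ^ Fintype.card H * B') :=
          Nat.mul_le_mul_left 100 (h1.trans (Nat.add_le_add_left h2 C))
      _ ≤ Fintype.card Nn ^ rr := hS1
  -- total
  rw [card_filter_prod_eq_sum, Finset.mul_sum]
  have hsplit := (Finset.sum_filter_add_sum_filter_not (univ : Finset (Fin rr → Nn))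
    (fun g => ¬Function.Injective g ∨ fib g < B') (fun g => 100 * badr g))
  simp only [hbadr] at hsplit ⊢
  rw [← hsplit]
  have hterm1 : ∑ g ∈ univ.filter (fun g => ¬Function.Injective g ∨ fib g < B'), 100 * badr g ≤
      Fintype.card Nn ^ rr * q ^ rows := by
    calc ∑ g ∈ univ.filter (fun g => ¬Function.Injective g ∨ fib g < B'), 100 * badr g
        ≤ ∑ _g ∈ univ.filter (fun g => ¬Function.Injective g ∨ fib g < B'), 100 * q ^ rows := by
          refine Finset.sum_le_sum fun g _ => Nat.mul_le_mul_left 100 ?_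
          have hcardΩ : Fintype.card ((U ⊕ S) ⊕ (H ⊕ Nn) → ZMod q) = q ^ rows := by
            rw [Fintype.card_fun, ZMod.card]
          exact (card_le_univ _).trans hcardΩ.le
      _ = #Gbad * (100 * q ^ rows) := by rw [Finset.sum_const, smul_eq_mul, hGbad]
      _ = 100 * #Gbad * q ^ rows := by ring
      _ ≤ Fintype.card Nn ^ rr * q ^ rows := Nat.mul_le_mul_right _ hGbad_card
  have hterm2 : ∑ g ∈ univ.filter (fun g => ¬(¬Function.Injective g ∨ fib g < B')), 100 * badr g ≤
      Fintype.card Nn ^ rr * q ^ rows := by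
    calc ∑ g ∈ univ.filter (fun g => ¬(¬Function.Injective g ∨ fib g < B')), 100 * badr g
        ≤ ∑ _g ∈ univ.filter (fun g => ¬(¬Function.Injective g ∨ fib g < B')), q ^ rows :=
          Finset.sum_le_sum fun g hg => hgood g (fun h => (mem_filter.1 hg).2 (mem_filter.1 h).2)
      _ ≤ ∑ _g ∈ (univ : Finset (Fin rr → Nn)), q ^ rows :=
          Finset.sum_le_sum_of_subset_of_nonneg (filter_subset _ _) fun _ _ _ => Nat.zero_le _
      _ = Fintype.card Nn ^ rr * q ^ rows := by
          rw [Finset.sum_const, smul_eq_mul, Finset.card_univ, Fintype.card_fun, Fintype.card_fin]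
  simp only [hbadr] at hterm1 hterm2
  omega

end Total


end Literature.Algebra.EuclideanLattices.Khot
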